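import Literature.Barriers.PneNP.TSPExtensionComplexityMatchings
import Mathlib.Data.Fintype.Pi
import Mathlib.Data.Fintype.BigOperators
import Mathlib.Algebra.BigOperators.Ring.Finset
import Mathlib.Logic.Function.Basic
import Mathlib.Data.Set.Function
import HarnessLib

/-!
# Perfect matchings: transport, block products, and the odd-cut parity lemma

Support file for the discharge of `Literature.Barriers.PneNP.Rothvoss2017_tsp`, continuing
`…Matchings.lean` (`IsPMOn S M`, `perfectMatchings S`). Three groups of elementary facts used
throughout Rothvoß's counting arguments (2017, §3) and in Edmonds' odd-set inequalities (§1):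

* **Transport** (`IsPMOn.image`, `perfectMatchings_image`, `card_perfectMatchings_image`,
  `card_perfectMatchings_eq_of_card_eq`): perfect matchings move along any map injective on the
  vertex set; in particular the NUMBER of perfect matchings of `S` depends only on `|S|` ("some
  (huge) constant depending on `k`", proof of Lemma 15, PDF p. 12).
* **Block products** (`isPMOn_biUnion`, `filter_biUnion_block`, `IsPMOn.filter_block`,
  `biUnion_filter_block`): for pairwise disjoint blocks `P i`, the perfect matchings of `⋃ P i`
  using no edge between different blocks correspond to families of perfect matchings of the
  blocks (`M ↦ (M ∩ E(P i))_i`, inverse `⋃`), the structure behind "`X := X₁ × … × X_{2m+1}`",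
  `X_i` = perfect matchings on a block (proof of Lemma 15).
* **Parity** (`cutCount`, `IsPMOn.card_eq_sum_cutCount`, `IsPMOn.one_le_card_cut`,
  `IsPMOn.card_cut_le`): for `U ⊆ S`, `|U| = Σ_{e ∈ M} |e ∩ U|`, hence for `|U|` odd some edge
  of `M` has exactly one endpoint in `U` — the validity of the odd-set inequalities
  `x(δ(U)) ≥ 1` on perfect matchings ("for parity reasons", PDF p. 6) — and the number of such
  edges is at most `|U|`.

All [folklore].
-/

namespace Literature.Barriers.PneNP

open Finset

variable {V W : Type*} [DecidableEq V] [DecidableEq W]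

/-! ### Transport along maps injective on the vertex set -/

omit [DecidableEq V] [DecidableEq W] in
/-- `Sym2.map f` is injective on pairs inside a set where `f` is injective. [folklore] -/
theorem sym2Map_injOn {f : V → W} {S : Finset V} (hf : Set.InjOn f S) {e₁ e₂ : Sym2 V}
    (h₁ : e₁ ∈ S.sym2) (h₂ : e₂ ∈ S.sym2) (heq : Sym2.map f e₁ = Sym2.map f e₂) : e₁ = e₂ := by
  induction e₁ using Sym2.ind with
  | h a b =>
    induction e₂ using Sym2.ind with
    | h c d =>
      rw [mk_mem_sym2_iff] at h₁ h₂
      rw [Sym2.map_mk, Sym2.map_mk, Sym2.eq_iff] at heq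
      rw [Sym2.eq_iff]
      rcases heq with ⟨hac, hbd⟩ | ⟨had, hbc⟩
      · exact Or.inl ⟨hf h₁.1 h₂.1 hac, hf h₁.2 h₂.2 hbd⟩
      · exact Or.inr ⟨hf h₁.1 h₂.2 had, hf h₁.2 h₂.1 hbc⟩

/-- **Transport**: the image of a perfect matching of `S` under a map injective on `S` is a
perfect matching of the image of `S`. [folklore] -/
theorem IsPMOn.image {S : Finset V} {M : Finset (Sym2 V)} (h : IsPMOn S M) (f : V → W)
    (hf : Set.InjOn f S) : IsPMOn (S.image f) (M.image (Sym2.map f)) := by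
  refine ⟨?_, ?_, ?_⟩
  · intro e he
    obtain ⟨e₀, he₀, rfl⟩ := mem_image.1 he
    rw [mem_sym2_iff]
    intro b hb
    obtain ⟨a, ha, rfl⟩ := Sym2.mem_map.1 hb
    exact mem_image_of_mem f (h.mem_of_mem he₀ ha)
  · intro e he
    obtain ⟨e₀, he₀, rfl⟩ := mem_image.1 he
    induction e₀ using Sym2.ind with
    | h a b =>
      rw [Sym2.map_mk, Sym2.mk_isDiag_iff]
      intro hab
      have ha := h.mem_of_mem he₀ (Sym2.mem_mk_left a b)
      have hb := h.mem_of_mem he₀ (Sym2.mem_mk_right a b)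
      exact h.not_isDiag he₀ (Sym2.mk_isDiag_iff.2 (hf ha hb hab))
  · intro w hw
    obtain ⟨v, hv, rfl⟩ := mem_image.1 hw
    have hfilter : ((M.image (Sym2.map f)).filter fun e => f v ∈ e) =
        (M.filter fun e => v ∈ e).image (Sym2.map f) := by
      ext e
      simp only [mem_filter, mem_image]
      constructor
      · rintro ⟨⟨e₀, he₀, rfl⟩, hve⟩
        obtain ⟨a, ha, hfa⟩ := Sym2.mem_map.1 hve
        have hav : a = v := hf (h.mem_of_mem he₀ ha) hv hfa
        subst hav
        exact ⟨e₀, ⟨he₀, ha⟩, rfl⟩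
      · rintro ⟨e₀, ⟨he₀, hve₀⟩, rfl⟩
        exact ⟨⟨e₀, he₀, rfl⟩, Sym2.mem_map.2 ⟨v, hve₀, rfl⟩⟩
    rw [hfilter, card_image_of_injOn, h.card_filter hv]
    intro e₁ he₁ e₂ he₂ heq
    exact sym2Map_injOn hf (h.subset_sym2 (mem_filter.1 (mem_coe.1 he₁)).1)
      (h.subset_sym2 (mem_filter.1 (mem_coe.1 he₂)).1) heq

/-- **The perfect matchings of the image are the images of the perfect matchings** (map
injective on `S`). [folklore] -/
theorem perfectMatchings_image (S : Finset V) (f : V → W) (hf : Set.InjOn f S) :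
    perfectMatchings (S.image f) =
      (perfectMatchings S).image fun M => M.image (Sym2.map f) := by
  ext N
  simp only [mem_image, mem_perfectMatchings]
  constructor
  · intro hN
    rcases S.eq_empty_or_nonempty with rfl | ⟨a, ha⟩
    · refine ⟨∅, IsPMOn.empty, ?_⟩
      rw [image_empty] at hN
      rw [hN.eq_empty, image_empty]
    · haveI : Nonempty V := ⟨a⟩
      set g : W → V := Function.invFunOn f (S : Set V) with hg
      have hgf : ∀ x ∈ S, g (f x) = x := fun x hx => hf.leftInvOn_invFunOn hx
      have hginj : Set.InjOn g (S.image f : Finset W) := by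
        intro y₁ hy₁ y₂ hy₂ heq
        obtain ⟨x₁, hx₁, rfl⟩ := mem_image.1 (mem_coe.1 hy₁)
        obtain ⟨x₂, hx₂, rfl⟩ := mem_image.1 (mem_coe.1 hy₂)
        rw [hgf x₁ hx₁, hgf x₂ hx₂] at heq
        rw [heq]
      have hback : (S.image f).image g = S := by
        rw [image_image]
        conv_rhs => rw [← image_id (s := S)]
        exact image_congr fun x hx => hgf x (mem_coe.1 hx)
      refine ⟨N.image (Sym2.map g), hback ▸ hN.image g hginj, ?_⟩
      rw [image_image]
      conv_rhs => rw [← image_id (s := N)]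
      refine image_congr fun e he => ?_
      have he' := hN.subset_sym2 (mem_coe.1 he)
      induction e using Sym2.ind with
      | h c d =>
        rw [mk_mem_sym2_iff] at he'
        obtain ⟨x, hx, rfl⟩ := mem_image.1 he'.1
        obtain ⟨y, hy, rfl⟩ := mem_image.1 he'.2
        simp only [Function.comp_apply, Sym2.map_mk, id_eq]
        rw [hgf x hx, hgf y hy]
  · rintro ⟨M, hM, rfl⟩
    exact hM.image f hf

/-- `M ↦ M.image (Sym2.map f)` is injective on the perfect matchings of `S` (map injective on
`S`). [folklore] -/
theorem image_sym2Map_injOn (S : Finset V) (f : V → W) (hf : Set.InjOn f S) :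
    Set.InjOn (fun M : Finset (Sym2 V) => M.image (Sym2.map f)) (perfectMatchings S) := by
  intro M₁ h₁ M₂ h₂ heq
  have h₁' := mem_perfectMatchings.1 (mem_coe.1 h₁)
  have h₂' := mem_perfectMatchings.1 (mem_coe.1 h₂)
  simp only at heq
  have key : ∀ {A B : Finset (Sym2 V)}, IsPMOn S A → IsPMOn S B →
      A.image (Sym2.map f) = B.image (Sym2.map f) → A ⊆ B := by
    intro A B hA hB hAB x hx
    have : Sym2.map f x ∈ B.image (Sym2.map f) := hAB ▸ mem_image_of_mem _ hx
    obtain ⟨y, hy, hyx⟩ := mem_image.1 this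
    rwa [← sym2Map_injOn hf (hB.subset_sym2 hy) (hA.subset_sym2 hx) hyx]
  exact Subset.antisymm (key h₁' h₂' heq) (key h₂' h₁' heq.symm)

/-- The number of perfect matchings is invariant under maps injective on the vertex set.
[folklore] -/
theorem card_perfectMatchings_image (S : Finset V) (f : V → W) (hf : Set.InjOn f S) :
    (perfectMatchings (S.image f)).card = (perfectMatchings S).card := by
  rw [perfectMatchings_image S f hf, card_image_of_injOn (image_sym2Map_injOn S f hf)]

/-- The number of perfect matchings of `S` is that of `Fin |S|`. [folklore] -/
theorem card_perfectMatchings_eq_fin (S : Finset V) :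
    (perfectMatchings S).card =
      (perfectMatchings (univ : Finset (Fin S.card))).card := by
  rcases S.eq_empty_or_nonempty with rfl | hne
  · -- both sides count the single empty matching
    have h1 : perfectMatchings (∅ : Finset V) = {∅} := by
      ext M
      rw [mem_perfectMatchings, mem_singleton]
      exact ⟨IsPMOn.eq_empty, fun h => h ▸ IsPMOn.empty⟩
    have h2 : perfectMatchings (univ : Finset (Fin (∅ : Finset V).card)) = {∅} := by
      ext M
      rw [mem_perfectMatchings, mem_singleton]
      have huniv : (univ : Finset (Fin (∅ : Finset V).card)) = ∅ := by
        rw [univ_eq_empty_iff]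
        simp only [card_empty]
        infer_instance
      rw [huniv]
      exact ⟨IsPMOn.eq_empty, fun h => h ▸ IsPMOn.empty⟩
    rw [h1, h2, card_singleton, card_singleton]
  · have hpos : 0 < S.card := hne.card_pos
    let f : V → Fin S.card := fun x => if hx : x ∈ S then S.equivFin ⟨x, hx⟩ else ⟨0, hpos⟩
    have hf : Set.InjOn f S := by
      intro x hx y hy hxy
      simp only [f, mem_coe.1 hx, mem_coe.1 hy, dif_pos] at hxy
      have := S.equivFin.injective hxy
      simpa using this
    have himg : S.image f = univ := by
      ext i
      simp only [mem_image, mem_univ, iff_true]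
      refine ⟨(S.equivFin.symm i : V), (S.equivFin.symm i).2, ?_⟩
      simp only [f, (S.equivFin.symm i).2, dif_pos]
      simp
    rw [← himg, card_perfectMatchings_image S f hf]

/-- **The number of perfect matchings depends only on the number of vertices.** [folklore] -/
theorem card_perfectMatchings_eq_of_card_eq {S : Finset V} {S' : Finset W}
    (h : S.card = S'.card) : (perfectMatchings S).card = (perfectMatchings S').card := by
  rw [card_perfectMatchings_eq_fin S, card_perfectMatchings_eq_fin S', h]

/-! ### Block products -/

section blocks

variable {ι : Type*} (P : ι → Finset V)

omit [DecidableEq V] in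
/-- A non-loop pair lies inside at most one of a family of pairwise disjoint blocks.
[folklore] -/
theorem block_unique (hP : ∀ i j, i ≠ j → Disjoint (P i) (P j)) {e : Sym2 V}
    {i j : ι} (hi : e ∈ (P i).sym2) (hj : e ∈ (P j).sym2) : i = j := by
  by_contra hij
  induction e using Sym2.ind with
  | h a b =>
    rw [mk_mem_sym2_iff] at hi hj
    exact disjoint_left.1 (hP i j hij) hi.1 hj.1

/-- **Gluing**: perfect matchings of pairwise disjoint blocks combine to a perfect matching of
their union using only edges inside blocks. [folklore] -/
theorem isPMOn_biUnion (hP : ∀ i j, i ≠ j → Disjoint (P i) (P j)) (s : Finset ι)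
    (f : ι → Finset (Sym2 V)) (hf : ∀ i ∈ s, IsPMOn (P i) (f i)) :
    IsPMOn (s.biUnion P) (s.biUnion f) := by
  classical
  induction s using Finset.induction_on with
  | empty => simpa using IsPMOn.empty
  | insert a s ha ih =>
    rw [biUnion_insert, biUnion_insert]
    refine (hf a (mem_insert_self a s)).union (ih fun i hi => hf i (mem_insert_of_mem hi)) ?_
    rw [disjoint_biUnion_right]
    intro i hi
    exact hP a i (fun h => ha (h ▸ hi))

/-- Edges of a glued matching lie inside blocks. [folklore] -/
theorem biUnion_respects (s : Finset ι) (f : ι → Finset (Sym2 V))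
    (hf : ∀ i ∈ s, IsPMOn (P i) (f i)) :
    ∀ e ∈ s.biUnion f, ∃ i ∈ s, e ∈ (P i).sym2 := by
  classical
  intro e he
  obtain ⟨i, hi, hei⟩ := mem_biUnion.1 he
  exact ⟨i, hi, (hf i hi).subset_sym2 hei⟩

/-- **Restricting a glued matching to a block recovers the block's matching.** [folklore] -/
theorem filter_biUnion_block (hP : ∀ i j, i ≠ j → Disjoint (P i) (P j)) (s : Finset ι)
    (f : ι → Finset (Sym2 V)) (hf : ∀ i ∈ s, IsPMOn (P i) (f i)) {i : ι} (hi : i ∈ s) :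
    ((s.biUnion f).filter fun e => e ∈ (P i).sym2) = f i := by
  classical
  ext e
  simp only [mem_filter, mem_biUnion]
  constructor
  · rintro ⟨⟨j, hj, hej⟩, hei⟩
    have hij : j = i :=
      block_unique P hP ((hf j hj).subset_sym2 hej) hei
    subst hij
    exact hej
  · intro he
    exact ⟨⟨i, hi, he⟩, (hf i hi).subset_sym2 he⟩

/-- **Restricting a block-respecting perfect matching to a block gives a perfect matching of the
block.** [folklore] -/
theorem IsPMOn.filter_block (hP : ∀ i j, i ≠ j → Disjoint (P i) (P j)) (s : Finset ι)
    {M : Finset (Sym2 V)} (hM : IsPMOn (s.biUnion P) M)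
    (hresp : ∀ e ∈ M, ∃ i ∈ s, e ∈ (P i).sym2) {i : ι} (hi : i ∈ s) :
    IsPMOn (P i) (M.filter fun e => e ∈ (P i).sym2) := by
  classical
  have hsplit : s.biUnion P = P i ∪ (s.erase i).biUnion P := by
    rw [← biUnion_insert, insert_erase hi]
  have hd : Disjoint (P i) ((s.erase i).biUnion P) := by
    rw [disjoint_biUnion_right]
    intro j hj
    exact hP i j (ne_of_mem_erase hj).symm
  rw [hsplit] at hM
  refine hM.filter_sym2 hd fun e he => ?_
  obtain ⟨j, hj, hej⟩ := hresp e he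
  by_cases hji : j = i
  · subst hji
    exact Or.inl hej
  · right
    exact sym2_mono (subset_biUnion_of_mem P (mem_erase.2 ⟨hji, hj⟩)) hej

omit [DecidableEq V] in
/-- A block-respecting matching is the union of its restrictions to the blocks. [folklore] -/
theorem biUnion_filter_block [DecidableEq V] (s : Finset ι) {M : Finset (Sym2 V)}
    (hresp : ∀ e ∈ M, ∃ i ∈ s, e ∈ (P i).sym2) :
    (s.biUnion fun i => M.filter fun e => e ∈ (P i).sym2) = M := by
  classical
  ext e
  simp only [mem_biUnion, mem_filter]
  constructor
  · rintro ⟨i, -, he, -⟩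
    exact he
  · intro he
    obtain ⟨i, hi, hei⟩ := hresp e he
    exact ⟨i, hi, he, hei⟩

/-- **The block decomposition is a bijection onto families of block matchings**, stated as the
four identities a counting argument needs (with `Fintype.piFinset`): for pairwise disjoint
blocks indexed by a finite type, (1) gluing a family of block matchings gives a
block-respecting perfect matching of the union, (2) whose restrictions are the family;
(3) restricting a block-respecting perfect matching gives a family of block matchings,
(4) which glues back to it. [folklore] -/
theorem blockPM_bij [Fintype ι] [DecidableEq ι] (hP : ∀ i j, i ≠ j → Disjoint (P i) (P j)) :
    (∀ g ∈ Fintype.piFinset fun i => perfectMatchings (P i),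
        (IsPMOn (univ.biUnion P) (univ.biUnion g) ∧
          ∀ e ∈ univ.biUnion g, ∃ i, e ∈ (P i).sym2) ∧
        (fun i => (univ.biUnion g).filter fun e => e ∈ (P i).sym2) = g) ∧
    (∀ M : Finset (Sym2 V), IsPMOn (univ.biUnion P) M → (∀ e ∈ M, ∃ i, e ∈ (P i).sym2) →
        (fun i => M.filter fun e => e ∈ (P i).sym2) ∈
            Fintype.piFinset (fun i => perfectMatchings (P i)) ∧
        (univ.biUnion fun i => M.filter fun e => e ∈ (P i).sym2) = M) := by
  constructor
  · intro g hg
    rw [Fintype.mem_piFinset] at hg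
    have hg' : ∀ i ∈ (univ : Finset ι), IsPMOn (P i) (g i) :=
      fun i _ => mem_perfectMatchings.1 (hg i)
    refine ⟨⟨isPMOn_biUnion P hP univ g hg', fun e he => ?_⟩, ?_⟩
    · obtain ⟨i, -, hi⟩ := biUnion_respects P univ g hg' e he
      exact ⟨i, hi⟩
    · funext i
      exact filter_biUnion_block P hP univ g hg' (mem_univ i)
  · intro M hM hresp
    have hresp' : ∀ e ∈ M, ∃ i ∈ (univ : Finset ι), e ∈ (P i).sym2 := fun e he => by
      obtain ⟨i, hi⟩ := hresp e he
      exact ⟨i, mem_univ i, hi⟩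
    refine ⟨?_, biUnion_filter_block P univ hresp'⟩
    rw [Fintype.mem_piFinset]
    intro i
    exact mem_perfectMatchings.2 (hM.filter_block P hP univ hresp' (mem_univ i))

/-- **Counting**: the number of block-respecting perfect matchings of the union is the product
of the numbers of perfect matchings of the blocks. [folklore] -/
theorem card_blockPM [Fintype ι] [DecidableEq ι] (hP : ∀ i j, i ≠ j → Disjoint (P i) (P j)) :
    ((perfectMatchings (univ.biUnion P)).filter
        fun M => ∀ e ∈ M, ∃ i, e ∈ (P i).sym2).card =
      ∏ i, (perfectMatchings (P i)).card := by
  rw [← Fintype.card_piFinset]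
  obtain ⟨h1, h2⟩ := blockPM_bij P hP
  refine card_nbij' (fun M i => M.filter fun e => e ∈ (P i).sym2) (fun g => univ.biUnion g)
    (fun M hM => ?_) (fun g hg => ?_) (fun M hM => ?_) (fun g hg => ?_)
  · rw [mem_coe, mem_filter, mem_perfectMatchings] at hM
    rw [mem_coe]
    exact (h2 M hM.1 hM.2).1
  · rw [mem_coe] at hg
    rw [mem_coe, mem_filter, mem_perfectMatchings]
    exact (h1 g hg).1
  · rw [mem_coe, mem_filter, mem_perfectMatchings] at hM
    exact (h2 M hM.1 hM.2).2
  · rw [mem_coe] at hg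
    exact (h1 g hg).2

end blocks

/-! ### Parity of cuts -/

/-- The number of endpoints of the pair `e` inside `U` (`0`, `1` or `2`). [folklore] -/
def cutCount (U : Finset V) : Sym2 V → ℕ :=
  Sym2.lift ⟨fun a b => (if a ∈ U then 1 else 0) + (if b ∈ U then 1 else 0),
    fun _ _ => add_comm _ _⟩

/-- `cutCount` on a pair. [folklore] -/
@[simp] theorem cutCount_mk (U : Finset V) (a b : V) :
    cutCount U s(a, b) = (if a ∈ U then 1 else 0) + (if b ∈ U then 1 else 0) := rfl

omit [DecidableEq V] in
/-- `cutCount ≤ 2`. [folklore] -/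
theorem cutCount_le_two [DecidableEq V] (U : Finset V) (e : Sym2 V) : cutCount U e ≤ 2 := by
  induction e using Sym2.ind with
  | h a b =>
    rw [cutCount_mk]
    split_ifs <;> omega

/-- The vertices of `U` on a non-loop pair are counted by `cutCount`. [folklore] -/
theorem card_filter_mem_eq_cutCount (U : Finset V) {e : Sym2 V} (he : ¬e.IsDiag) :
    (U.filter fun v => v ∈ e).card = cutCount U e := by
  induction e using Sym2.ind with
  | h a b =>
    rw [Sym2.mk_isDiag_iff] at he
    rw [cutCount_mk]
    have hsplit : (U.filter fun v => v ∈ s(a, b)) = U.filter (fun v => v = a) ∪ U.filter fun v => v = b := by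
      ext v
      simp only [mem_filter, Sym2.mem_iff, mem_union]
      tauto
    rw [hsplit, card_union_of_disjoint]
    · rw [filter_eq', filter_eq']
      split_ifs <;> simp
    · rw [disjoint_left]
      intro v hv hv'
      rw [mem_filter] at hv hv'
      exact he (hv.2.symm.trans hv'.2)

/-- **`|U| = Σ_{e ∈ M} |e ∩ U|`** for a perfect matching `M` of `S ⊇ U` (double counting of
incidences). [folklore] -/
theorem IsPMOn.card_eq_sum_cutCount {S : Finset V} {M : Finset (Sym2 V)} (h : IsPMOn S M)
    {U : Finset V} (hU : U ⊆ S) : U.card = ∑ e ∈ M, cutCount U e := by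
  calc U.card = ∑ _v ∈ U, 1 := Finset.card_eq_sum_ones U
    _ = ∑ v ∈ U, (M.filter fun e => v ∈ e).card :=
        Finset.sum_congr rfl fun v hv => (h.card_filter (hU hv)).symm
    _ = ∑ v ∈ U, ∑ e ∈ M, (if v ∈ e then 1 else 0) :=
        Finset.sum_congr rfl fun v _ => Finset.card_filter _ _
    _ = ∑ e ∈ M, ∑ v ∈ U, (if v ∈ e then 1 else 0) := Finset.sum_comm
    _ = ∑ e ∈ M, (U.filter fun v => v ∈ e).card :=
        Finset.sum_congr rfl fun e _ => (Finset.card_filter _ _).symm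
    _ = ∑ e ∈ M, cutCount U e :=
        Finset.sum_congr rfl fun e he => card_filter_mem_eq_cutCount U (h.not_isDiag he)

/-- `Σ_e cutCount = #{cut edges} + 2 · #{inner edges}`. [folklore] -/
theorem sum_cutCount_eq (U : Finset V) (M : Finset (Sym2 V)) :
    ∑ e ∈ M, cutCount U e =
      (M.filter fun e => cutCount U e = 1).card + 2 * (M.filter fun e => cutCount U e = 2).card := by
  rw [Finset.card_filter, Finset.card_filter, mul_sum, ← sum_add_distrib]
  refine sum_congr rfl fun e _ => ?_
  have := cutCount_le_two U e
  rcases Nat.lt_or_ge (cutCount U e) 1 with h0 | h1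
  · have : cutCount U e = 0 := by omega
    simp [this]
  · rcases Nat.lt_or_ge (cutCount U e) 2 with h1' | h2
    · have : cutCount U e = 1 := by omega
      simp [this]
    · have : cutCount U e = 2 := by omega
      simp [this]

/-- **Odd cuts are crossed** ("for parity reasons"): if `M` is a perfect matching of `S` and
`U ⊆ S` has odd size, then an odd number — in particular at least one — of the edges of `M` has
exactly one endpoint in `U`. [cite: Rothvoss2017, §2 (PDF p. 6)] -/
theorem IsPMOn.one_le_card_cut {S : Finset V} {M : Finset (Sym2 V)} (h : IsPMOn S M)
    {U : Finset V} (hU : U ⊆ S) (hodd : Odd U.card) :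
    1 ≤ (M.filter fun e => cutCount U e = 1).card := by
  have h1 := h.card_eq_sum_cutCount hU
  rw [sum_cutCount_eq] at h1
  obtain ⟨k, hk⟩ := hodd
  omega

/-- The number of edges of `M` with exactly one endpoint in `U ⊆ S` is at most `|U|`.
[folklore] -/
theorem IsPMOn.card_cut_le {S : Finset V} {M : Finset (Sym2 V)} (h : IsPMOn S M)
    {U : Finset V} (hU : U ⊆ S) : (M.filter fun e => cutCount U e = 1).card ≤ U.card := by
  have h1 := h.card_eq_sum_cutCount hU
  rw [sum_cutCount_eq] at h1
  omega

end Literature.Barriers.PneNP
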